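import Summits.NavierStokesRegularity.NavierStokesRegularity.Theorems.CircuitTrace.Negative.Structure

/-!
# `PerpetualPump.CircuitTrace` (stmt-NavierStokesRegularity-1836), line `tilted-trace-gronwall`:
# stub S2b `quietImpliesRegular` — part I, the sign of `X Ẋ` at a weighted touching time

Helper file (kind = proof) for the stub `stub_quietImpliesRegular` ("an `ε₀`-quiet half-line
`{j ≥ n}` is `H¹⁰`-regular", part II: `PerpetualPumpCircuitTraceQuietImpliesRegular.lean`) of the
lead's skeleton for crux `PerpetualPump.CircuitTrace` (Tao's viscous dyadic circuit (4.3) at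
`α = 2/5`, `circuitRHS` of `Theorems/CircuitTrace/Negative/LoadBearing.lean`). It is the local
computation behind the `θ`-weighted maximum principle for the weights
`w_{i,j} = θ^j lam^{4j}|X_{i,j}|`, `j > n`, above an `ε`-quiet half-line `{k ≥ n}`:

* `quietImpliesRegular_term_bound` — every quadratic monomial of `Ẋ_{i,j}`, times the weight
  factor `θ^j lam^{4j}`, is `≤ K lam^{4j/5}(ε lam^{16/5} W + ε² lam^{(19n+16)/5})`: one factor is
  bounded in critical units by `ε`, the other through the weight level `W` (the `(j-1)²` source
  costs `θ lam^{16/5}`; at `j = n+1` it is the valve forcing, both factors at scale `n`);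
* `quietImpliesRegular_sign` (registered sub-goal) — hence at a touching time `w_{i,j} = W` of a
  level `W > 2β₂`, `β₂ = 4m²Kε² lam^{(19n+16)/5}`, with `4m²Kε lam^{16/5} ≤ 1/2`, one has
  `X_{i,j} Ẋ_{i,j} < 0`. [folklore]
-/

set_option linter.dupNamespace false

noncomputable section

namespace Summit.NavierStokesRegularity.NavierStokesRegularity.Theorems.PerpetualPumpCircuitTrace

open Finset Real Set Filter Topology
open Summit.NavierStokesRegularity.NavierStokesRegularity.Theorems.CircuitTrace.Negative

/-- **Per-monomial bound at a weighted touching time.** Fix a time `t`, a valve scale `n ≥ 0`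
and a block scale `j > n`. If every mode at scales `k ≥ n` is `ε`-quiet in critical units
(`lam^{k/5}|X_{i,k}| ≤ ε`) and every block mode `k > n` has weight
`θ^k lam^{4k}|X_{i,k}| ≤ W` (`0 < θ ≤ 1`), then each quadratic monomial of `Ẋ_{i,j}`, multiplied
by the weight factor `θ^j lam^{4j}`, is at most
`K lam^{4j/5} (ε lam^{16/5} W + ε² lam^{(19n+16)/5})`: one factor is bounded by the amplitude,
the other by the weight (offsets `(0,0,0)`, `(1,0,0)`, `(0,1,0)`, and `(0,0,1)` for `j ≥ n+2`, the
latter at the price `θ lam^{16/5}`), except the valve source `(0,0,1)` at `j = n+1`, where both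
factors sit at scale `n` and are bounded by the amplitude. [folklore] -/
theorem quietImpliesRegular_term_bound {lam : ℝ} (hlam : 1 < lam) {m : ℕ}
    (coeff : Fin m → Fin m → Fin m → Option (Fin 3) → ℝ) {K : ℝ} (hK0 : 0 ≤ K)
    (hK : ∀ i₁ i₂ i₃ μ, |coeff i₁ i₂ i₃ μ| ≤ K) (X : Fin m → ℤ → ℝ → ℝ) (t : ℝ)
    {n j : ℤ} (hn : 0 ≤ n) (hj : n < j) {ε : ℝ} (hε0 : 0 ≤ ε)
    (hamp : ∀ (i : Fin m) (k : ℤ), n ≤ k → lam ^ ((1 / 5 : ℝ) * k) * |X i k t| ≤ ε)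
    {θ : ℝ} (hθ0 : 0 < θ) (hθ1 : θ ≤ 1) {W : ℝ} (hW0 : 0 ≤ W)
    (hwt : ∀ (i : Fin m) (k : ℤ), n < k → θ ^ (k : ℝ) * (lam ^ ((4 : ℝ) * k) * |X i k t|) ≤ W)
    (i i₁ i₂ : Fin m) (μ : Option (Fin 3)) :
    θ ^ (j : ℝ) * lam ^ ((4 : ℝ) * j) *
      |coeff i₁ i₂ i μ * lam ^ ((j : ℝ) - (if μ = some 2 then 1 else 0)) *
        X i₁ (j + ((if μ = some 0 then 1 else 0) - (if μ = some 2 then 1 else 0))) t *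
        X i₂ (j + ((if μ = some 1 then 1 else 0) - (if μ = some 2 then 1 else 0))) t|
      ≤ K * lam ^ ((4 / 5 : ℝ) * j) *
        (ε * lam ^ (16 / 5 : ℝ) * W + ε ^ 2 * lam ^ (((19 : ℝ) * n + 16) / 5)) := by
  have hlam0 : 0 < lam := by linarith
  have hpos : ∀ e : ℝ, 0 < lam ^ e := fun e => Real.rpow_pos_of_pos hlam0 e
  have hmul : ∀ a b : ℝ, lam ^ a * lam ^ b = lam ^ (a + b) := fun a b =>
    (Real.rpow_add hlam0 a b).symm
  have hmono : ∀ a b : ℝ, a ≤ b → lam ^ a ≤ lam ^ b := fun a b h =>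
    Real.rpow_le_rpow_of_exponent_le hlam.le h
  have hθpos : ∀ e : ℝ, 0 < θ ^ e := fun e => Real.rpow_pos_of_pos hθ0 e
  set L := lam ^ (16 / 5 : ℝ) with hL
  have hL0 : 0 < L := hpos _
  have hL1 : 1 ≤ L := Real.one_le_rpow hlam.le (by norm_num)
  set lam45 := lam ^ ((4 / 5 : ℝ) * j) with h45
  have h45pos : 0 < lam45 := hpos _
  set B := lam ^ (((19 : ℝ) * n + 16) / 5) with hB
  have hB0 : 0 < B := hpos _
  have hKl : 0 ≤ K * lam45 := mul_nonneg hK0 h45pos.le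
  have hfin0 : K * lam45 * (ε * W) ≤ K * lam45 * (ε * L * W + ε ^ 2 * B) := by
    apply mul_le_mul_of_nonneg_left _ hKl
    have h1 : ε * W * 1 ≤ ε * W * L := mul_le_mul_of_nonneg_left hL1 (mul_nonneg hε0 hW0)
    have h2 : 0 ≤ ε ^ 2 * B := by positivity
    nlinarith
  have hfin1 : K * lam45 * (ε * L * W) ≤ K * lam45 * (ε * L * W + ε ^ 2 * B) := by
    apply mul_le_mul_of_nonneg_left _ hKl
    have h2 : 0 ≤ ε ^ 2 * B := by positivity
    linarith
  have hfin2 : K * lam45 * (ε ^ 2 * B) ≤ K * lam45 * (ε * L * W + ε ^ 2 * B) := by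
    apply mul_le_mul_of_nonneg_left _ hKl
    have h2 : 0 ≤ ε * L * W := by positivity
    linarith
  have hsplit : lam ^ (j : ℝ) = lam45 * lam ^ ((1 / 5 : ℝ) * j) := by
    rw [h45, hmul]
    congr 1
    ring
  rw [abs_mul, abs_mul, abs_mul, abs_of_nonneg (hpos _).le]
  have hc := hK i₁ i₂ i μ
  rcases μ with _ | a
  · -- offset `(0,0,0)`: amplitude on `X_{i₁,j}`, weight on `X_{i₂,j}`
    simp only [reduceCtorEq, ite_false, sub_zero, add_zero]
    have ha1 := hamp i₁ j hj.le
    have hw2 := hwt i₂ j hj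
    calc θ ^ (j : ℝ) * lam ^ ((4 : ℝ) * j) *
          (|coeff i₁ i₂ i none| * lam ^ (j : ℝ) * |X i₁ j t| * |X i₂ j t|)
        = |coeff i₁ i₂ i none| * (lam45 * (lam ^ ((1 / 5 : ℝ) * j) * |X i₁ j t|)) *
            (θ ^ (j : ℝ) * (lam ^ ((4 : ℝ) * j) * |X i₂ j t|)) := by
          rw [hsplit]; ring
      _ ≤ K * (lam45 * ε) * W :=
          mul_le_mul (mul_le_mul hc (mul_le_mul_of_nonneg_left ha1 h45pos.le) (by positivity)
            hK0) hw2 (by positivity) (by positivity)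
      _ = K * lam45 * (ε * W) := by ring
      _ ≤ _ := hfin0
  · fin_cases a
    · -- offset `(1,0,0)`: amplitude on `X_{i₁,j+1}`, weight on `X_{i₂,j}`
      simp only [Fin.zero_eta, Fin.isValue, Option.some.injEq, Fin.reduceEq, ite_false,
        sub_zero, ite_true, add_zero]
      have ha1 : lam ^ ((1 / 5 : ℝ) * j) * |X i₁ (j + 1) t| ≤ ε := by
        refine le_trans (mul_le_mul_of_nonneg_right (hmono _ _ ?_) (abs_nonneg _))
          (hamp i₁ (j + 1) (by omega))
        push_cast
        linarith
      have hw2 := hwt i₂ j hj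
      calc θ ^ (j : ℝ) * lam ^ ((4 : ℝ) * j) *
            (|coeff i₁ i₂ i (some 0)| * lam ^ (j : ℝ) * |X i₁ (j + 1) t| * |X i₂ j t|)
          = |coeff i₁ i₂ i (some 0)| * (lam45 * (lam ^ ((1 / 5 : ℝ) * j) * |X i₁ (j + 1) t|)) *
              (θ ^ (j : ℝ) * (lam ^ ((4 : ℝ) * j) * |X i₂ j t|)) := by
            rw [hsplit]; ring
        _ ≤ K * (lam45 * ε) * W :=
            mul_le_mul (mul_le_mul hc (mul_le_mul_of_nonneg_left ha1 h45pos.le) (by positivity)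
              hK0) hw2 (by positivity) (by positivity)
        _ = K * lam45 * (ε * W) := by ring
        _ ≤ _ := hfin0
    · -- offset `(0,1,0)`: weight on `X_{i₁,j}`, amplitude on `X_{i₂,j+1}`
      simp only [Fin.mk_one, Fin.isValue, Option.some.injEq, Fin.reduceEq, ite_false,
        sub_zero, add_zero, ite_true]
      have hw1 := hwt i₁ j hj
      have ha2 : lam ^ ((1 / 5 : ℝ) * j) * |X i₂ (j + 1) t| ≤ ε := by
        refine le_trans (mul_le_mul_of_nonneg_right (hmono _ _ ?_) (abs_nonneg _))
          (hamp i₂ (j + 1) (by omega))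
        push_cast
        linarith
      calc θ ^ (j : ℝ) * lam ^ ((4 : ℝ) * j) *
            (|coeff i₁ i₂ i (some 1)| * lam ^ (j : ℝ) * |X i₁ j t| * |X i₂ (j + 1) t|)
          = |coeff i₁ i₂ i (some 1)| * (θ ^ (j : ℝ) * (lam ^ ((4 : ℝ) * j) * |X i₁ j t|)) *
              (lam45 * (lam ^ ((1 / 5 : ℝ) * j) * |X i₂ (j + 1) t|)) := by
            rw [hsplit]; ring
        _ ≤ K * W * (lam45 * ε) :=
            mul_le_mul (mul_le_mul hc hw1 (by positivity) hK0)
              (mul_le_mul_of_nonneg_left ha2 h45pos.le) (by positivity) (by positivity)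
        _ = K * lam45 * (ε * W) := by ring
        _ ≤ _ := hfin0
    · -- offset `(0,0,1)`: the source from scale `j - 1`
      simp only [Fin.reduceFinMk, Fin.isValue, ite_true, Option.some.injEq, Fin.reduceEq,
        ite_false, zero_sub]
      rcases lt_or_eq_of_le (show n + 1 ≤ j by omega) with hlt | heq
      · -- `j ≥ n + 2`: amplitude on `X_{i₁,j-1}`, weight on `X_{i₂,j-1}`, price `θ lam^{16/5}`
        have ha1 := hamp i₁ (j + -1) (by omega)
        have hw2 := hwt i₂ (j + -1) (by omega)
        have hθsplit : θ ^ (j : ℝ) = θ ^ ((j + -1 : ℤ) : ℝ) * θ := by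
          rw [← Real.rpow_add_one hθ0.ne']
          congr 1
          push_cast
          ring
        have hlamid : lam ^ ((4 : ℝ) * j) * lam ^ ((j : ℝ) - 1)
            = lam ^ ((4 : ℝ) * ((j + -1 : ℤ) : ℝ)) * lam ^ ((1 / 5 : ℝ) * ((j + -1 : ℤ) : ℝ)) *
                (lam45 * L) := by
          rw [h45, hL]
          simp only [hmul]
          congr 1
          push_cast
          ring
        calc θ ^ (j : ℝ) * lam ^ ((4 : ℝ) * j) *
              (|coeff i₁ i₂ i (some 2)| * lam ^ ((j : ℝ) - 1) * |X i₁ (j + -1) t| *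
                |X i₂ (j + -1) t|)
            = θ ^ (j : ℝ) * (lam ^ ((4 : ℝ) * j) * lam ^ ((j : ℝ) - 1)) *
                |coeff i₁ i₂ i (some 2)| * |X i₁ (j + -1) t| * |X i₂ (j + -1) t| := by ring
          _ = θ ^ ((j + -1 : ℤ) : ℝ) * θ *
                (lam ^ ((4 : ℝ) * ((j + -1 : ℤ) : ℝ)) * lam ^ ((1 / 5 : ℝ) * ((j + -1 : ℤ) : ℝ)) *
                  (lam45 * L)) *
                |coeff i₁ i₂ i (some 2)| * |X i₁ (j + -1) t| * |X i₂ (j + -1) t| := by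
              rw [hθsplit, hlamid]
          _ = θ * (|coeff i₁ i₂ i (some 2)| *
                (lam ^ ((1 / 5 : ℝ) * ((j + -1 : ℤ) : ℝ)) * |X i₁ (j + -1) t|) *
                (θ ^ ((j + -1 : ℤ) : ℝ) * (lam ^ ((4 : ℝ) * ((j + -1 : ℤ) : ℝ)) *
                  |X i₂ (j + -1) t|))) * (lam45 * L) := by ring
          _ ≤ 1 * (K * ε * W) * (lam45 * L) := by
              apply mul_le_mul_of_nonneg_right _ (by positivity)
              exact mul_le_mul hθ1 (mul_le_mul (mul_le_mul hc ha1 (by positivity) hK0) hw2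
                (by positivity) (by positivity)) (by positivity) zero_le_one
          _ = K * lam45 * (ε * L * W) := by ring
          _ ≤ _ := hfin1
      · -- `j = n + 1`: the valve source, both factors at scale `n` bounded by the amplitude
        subst heq
        have hn1 : n + 1 + -1 = n := by ring
        rw [hn1]
        have ha1 := hamp i₁ n le_rfl
        have ha2 := hamp i₂ n le_rfl
        have hθ1' : θ ^ ((n + 1 : ℤ) : ℝ) ≤ 1 :=
          Real.rpow_le_one hθ0.le hθ1 (by exact_mod_cast (by omega : (0 : ℤ) ≤ n + 1))
        have hlamid : lam ^ ((4 : ℝ) * ((n + 1 : ℤ) : ℝ)) * lam ^ (((n + 1 : ℤ) : ℝ) - 1)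
            = lam ^ ((1 / 5 : ℝ) * n) * lam ^ ((1 / 5 : ℝ) * n) * (lam45 * B) := by
          rw [h45, hB]
          simp only [hmul]
          congr 1
          push_cast
          ring
        calc θ ^ ((n + 1 : ℤ) : ℝ) * lam ^ ((4 : ℝ) * ((n + 1 : ℤ) : ℝ)) *
              (|coeff i₁ i₂ i (some 2)| * lam ^ (((n + 1 : ℤ) : ℝ) - 1) * |X i₁ n t| *
                |X i₂ n t|)
            = θ ^ ((n + 1 : ℤ) : ℝ) *
                (lam ^ ((4 : ℝ) * ((n + 1 : ℤ) : ℝ)) * lam ^ (((n + 1 : ℤ) : ℝ) - 1)) *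
                |coeff i₁ i₂ i (some 2)| * |X i₁ n t| * |X i₂ n t| := by ring
          _ = θ ^ ((n + 1 : ℤ) : ℝ) *
                (lam ^ ((1 / 5 : ℝ) * n) * lam ^ ((1 / 5 : ℝ) * n) * (lam45 * B)) *
                |coeff i₁ i₂ i (some 2)| * |X i₁ n t| * |X i₂ n t| := by rw [hlamid]
          _ = θ ^ ((n + 1 : ℤ) : ℝ) * (|coeff i₁ i₂ i (some 2)| *
                (lam ^ ((1 / 5 : ℝ) * n) * |X i₁ n t|) * (lam ^ ((1 / 5 : ℝ) * n) * |X i₂ n t|)) *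
                (lam45 * B) := by ring
          _ ≤ 1 * (K * ε * ε) * (lam45 * B) := by
              apply mul_le_mul_of_nonneg_right _ (by positivity)
              exact mul_le_mul hθ1' (mul_le_mul (mul_le_mul hc ha1 (by positivity) hK0) ha2
                (by positivity) (by positivity)) (by positivity) zero_le_one
          _ = K * lam45 * (ε ^ 2 * B) := by ring
          _ ≤ _ := hfin2

/-- **Sign at a weighted touching time** (registered sub-goal of `stub_quietImpliesRegular`). Fix a
time `t`, a valve scale `n ≥ 0`, a block scale `j > n`, `0 < θ ≤ 1` and a level `W`. If every mode
at scales `k ≥ n` is `ε`-quiet in critical units at `t` (`lam^{k/5}|X_{i,k}(t)| ≤ ε`), every block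
mode `k > n` has weight `θ^k lam^{4k}|X_{i,k}(t)| ≤ W`, `4m²Kε lam^{16/5} ≤ 1/2` (`K` bounds the
structure constants), `W` exceeds twice the valve forcing `β₂ = 4m²K ε² lam^{(19n+16)/5}`, and the
block mode `(i, j)` touches the level, `θ^j lam^{4j}|X_{i,j}(t)| = W`, then `X_{i,j} Ẋ_{i,j} < 0` at
`t`: multiplying by the squared weight, `θ^{2j}lam^{8j} X_{i,j}Ẋ_{i,j} ≤ lam^{4j/5} W (-W + W/2 + β₂) < 0`
(`quietImpliesRegular_term_bound` summed over the `4m²` monomials). [folklore] -/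
theorem quietImpliesRegular_sign :
    ∀ lam : ℝ, 1 < lam → ∀ (m : ℕ) (coeff : Fin m → Fin m → Fin m → Option (Fin 3) → ℝ) (K : ℝ),
    0 ≤ K → (∀ (i₁ i₂ i₃ : Fin m) (μ : Option (Fin 3)), |coeff i₁ i₂ i₃ μ| ≤ K) →
    ∀ (X : Fin m → ℤ → ℝ → ℝ) (t : ℝ) (n j : ℤ), 0 ≤ n → n < j → ∀ ε : ℝ, 0 ≤ ε →
    (∀ (i : Fin m) (k : ℤ), n ≤ k → lam ^ ((1 / 5 : ℝ) * k) * |X i k t| ≤ ε) →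
    ∀ θ : ℝ, 0 < θ → θ ≤ 1 → ∀ W : ℝ,
    (∀ (i : Fin m) (k : ℤ), n < k → θ ^ (k : ℝ) * (lam ^ ((4 : ℝ) * k) * |X i k t|) ≤ W) →
    4 * (m : ℝ) ^ 2 * K * ε * lam ^ (16 / 5 : ℝ) ≤ 1 / 2 →
    2 * (4 * (m : ℝ) ^ 2 * K * (ε ^ 2 * lam ^ (((19 : ℝ) * n + 16) / 5))) < W →
    ∀ i : Fin m, θ ^ (j : ℝ) * (lam ^ ((4 : ℝ) * j) * |X i j t|) = W →
    X i j t * circuitRHS lam coeff X i j t < 0 := by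
  intro lam hlam m coeff K hK0 hK X t n j hn hj ε hε0 hamp θ hθ0 hθ1 W hwt hη hWβ i htouch
  have hlam0 : 0 < lam := by linarith
  have hW0 : 0 < W := by
    have : 0 ≤ 4 * (m : ℝ) ^ 2 * K * (ε ^ 2 * lam ^ (((19 : ℝ) * n + 16) / 5)) := by positivity
    linarith
  have hterm := quietImpliesRegular_term_bound hlam coeff hK0 hK X t hn hj hε0 hamp hθ0 hθ1
    hW0.le hwt i
  set P := θ ^ (j : ℝ) * lam ^ ((4 : ℝ) * j) with hP
  have hPpos : 0 < P := mul_pos (Real.rpow_pos_of_pos hθ0 _) (Real.rpow_pos_of_pos hlam0 _)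
  set lam45 := lam ^ ((4 / 5 : ℝ) * j) with h45
  have h45pos : 0 < lam45 := Real.rpow_pos_of_pos hlam0 _
  set L := lam ^ (16 / 5 : ℝ) with hL
  set β₀ := ε ^ 2 * lam ^ (((19 : ℝ) * n + 16) / 5) with hβ₀
  set η := 4 * (m : ℝ) ^ 2 * K * ε * L with hηdef
  set β₂ := 4 * (m : ℝ) ^ 2 * K * β₀ with hβ₂
  set x := X i j t with hx
  set body : Fin m → Fin m → Option (Fin 3) → ℝ := fun i₁ i₂ μ =>
    coeff i₁ i₂ i μ * lam ^ ((j : ℝ) - (if μ = some 2 then 1 else 0)) *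
      X i₁ (j + ((if μ = some 0 then 1 else 0) - (if μ = some 2 then 1 else 0))) t *
      X i₂ (j + ((if μ = some 1 then 1 else 0) - (if μ = some 2 then 1 else 0))) t with hbody
  set Q := ∑ i₁ : Fin m, ∑ i₂ : Fin m, ∑ μ : Option (Fin 3), body i₁ i₂ μ with hQ
  have hF : circuitRHS lam coeff X i j t = -lam45 * x + Q := rfl
  have htouch' : P * |x| = W := by rw [hP, mul_assoc]; exact htouch
  -- the quadratic part against the weight
  have hQb : P * |Q| ≤ lam45 * (η * W + β₂) := by
    have hsum : |Q| ≤ ∑ i₁ : Fin m, ∑ i₂ : Fin m, ∑ μ : Option (Fin 3), |body i₁ i₂ μ| :=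
      (Finset.abs_sum_le_sum_abs _ _).trans (Finset.sum_le_sum fun i₁ _ =>
        (Finset.abs_sum_le_sum_abs _ _).trans (Finset.sum_le_sum fun i₂ _ =>
          Finset.abs_sum_le_sum_abs _ _))
    calc P * |Q| ≤ P * ∑ i₁ : Fin m, ∑ i₂ : Fin m, ∑ μ : Option (Fin 3), |body i₁ i₂ μ| :=
          mul_le_mul_of_nonneg_left hsum hPpos.le
      _ = ∑ i₁ : Fin m, ∑ i₂ : Fin m, ∑ μ : Option (Fin 3), P * |body i₁ i₂ μ| := by
          simp only [Finset.mul_sum]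
      _ ≤ ∑ _i₁ : Fin m, ∑ _i₂ : Fin m, ∑ _μ : Option (Fin 3),
            K * lam45 * (ε * L * W + β₀) :=
          Finset.sum_le_sum fun i₁ _ => Finset.sum_le_sum fun i₂ _ =>
            Finset.sum_le_sum fun μ _ => hterm i₁ i₂ μ
      _ = lam45 * (η * W + β₂) := by
          simp only [Finset.sum_const, Finset.card_univ, Fintype.card_option, Fintype.card_fin]
          push_cast
          ring
  rw [hF]
  have hPx : |P * x| = W := by rw [abs_mul, abs_of_pos hPpos]; exact htouch'
  have hcross : P * x * (P * Q) ≤ W * (lam45 * (η * W + β₂)) :=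
    calc P * x * (P * Q) ≤ |P * x * (P * Q)| := le_abs_self _
      _ = W * (P * |Q|) := by rw [abs_mul, hPx, abs_mul, abs_of_pos hPpos]
      _ ≤ W * (lam45 * (η * W + β₂)) := mul_le_mul_of_nonneg_left hQb hW0.le
  have hsq : (P * x) ^ 2 = W ^ 2 := by rw [← hPx, sq_abs]
  have hηW : η * W ≤ 1 / 2 * W := mul_le_mul_of_nonneg_right hη hW0.le
  have hneg : η * W + β₂ - W < 0 := by linarith
  have hprod : P ^ 2 * (x * (-lam45 * x + Q)) < 0 := by
    have hid : P ^ 2 * (x * (-lam45 * x + Q)) = -lam45 * (P * x) ^ 2 + P * x * (P * Q) := by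
      ring
    rw [hid, hsq]
    have h3 : lam45 * W * (η * W + β₂ - W) < 0 := mul_neg_of_pos_of_neg (mul_pos h45pos hW0) hneg
    calc -lam45 * W ^ 2 + P * x * (P * Q) ≤ -lam45 * W ^ 2 + W * (lam45 * (η * W + β₂)) := by
          linarith [hcross]
      _ = lam45 * W * (η * W + β₂ - W) := by ring
      _ < 0 := h3
  by_contra hge
  push Not at hge
  have := mul_nonneg (pow_nonneg hPpos.le 2) hge
  linarith

end Summit.NavierStokesRegularity.NavierStokesRegularity.Theorems.PerpetualPumpCircuitTrace

end
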